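import Summits.ResolutionOfSingularities.ResolutionOfSingularities.Theorems.FrobeniusClosingSteerArithTransportSatellite
import Summits.ResolutionOfSingularities.ResolutionOfSingularities.Theorems.FrobeniusClosingSteerArithConeLocal
import Literature.AlgebraicGeometry.Resolution.RegularLocalRingsProofs
import HarnessLib

/-!
# Crux `Steer` (stmt-ResolutionOfSingularities-16345), β-leaf debt K-β0(a) — lemma (N) NEAR-A, part 1: the PARITY BOUND at a landing
  (res-D-pv-053 g9; res-L0-w41-plan-1 RULING 317 (c); reader res-L0-w41-tri-1 g8; memo `D/res-D-pv-053/K-BETA0A-SCOPE.md` §4)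

OURS (campaign `res-hironaka`, rung L ★L-G4, slot W4.1). Candidates' vocabulary made kernel; nothing here is a statement of H. Hironaka's manuscript
[Hironaka2017] (status: under review). AI-written; AI review is weaker than expert review. Def-free, Theses-free, 0 sorries.

## What is proved (one visit pair of a σ_top-steered run, `p = 2`, characteristic `2`) — `NearA.parityBound`

Data: a steered run with `R 0` dominated by `O` and regular members; a visit pair `(j, j′)`; an exceptional parameter `u` of the point step `j`
with its strip clause between `j` and `j′` and N4's height-one clause at `j′` (the diet of `VisitLawDelta.visitLaw₂_of_run`); the member at `j` has
ODD cleaned order `d ≥ 3` and the member at `j′` has cleaned order `d + 1` (the A → B typing of a late visit; NO cone shape is assumed at either end —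
this is the «e-free» half of the pull-back computation, and exactly what the K-β0(a) dynamical induction consumes).
Conclusion: `R j′ = R (j+1)`; `u` is a regular parameter and a prime of `R j′`; and for EVERY cleaner `g` at `j` (`f_j − g² ∈ 𝔪_j^d`) the weak
transform `f₁ = (f_j − g²)/u^d ∈ R j′` satisfies the PARITY BOUND  `f₁ − u·q² ∈ 𝔪_{j′}^d`  for some `q ∈ R j′`.

Proof («a square has no odd part»): the visit law `s_{j′}·u^((d−1)/2)·W = s_j − G` squares (characteristic two) to `u^(d−1)·(u f₁ + W² f_{j′}) = (g + G)²`,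
so `u f₁ + W² f_{j′} = T²` in the integrally closed domain `R j′` (`ArithTransport.sq_of_pow_mul_eq_sq`); a cleaner `h` at `j′` gives
`u f₁ + (T + W h)² = W²(f_{j′} − h²) ∈ 𝔪′^(d+1)`; modulo the regular parameter `u` the ring `R j′/(u)` is regular, so `ord(V̄²) = 2·ord(V̄) ≥ d+1` forces
`V = V₀ + u V₁` with `V₀ ∈ 𝔪′^((d+1)/2)`, whence `u·(f₁ + u V₁²) ∈ 𝔪′^(d+1)` and `f₁ + u V₁² ∈ 𝔪′^d` (`ord u = 1`, orders add).
Part 2 (`…ArithNearACone`, next) reads the cone off this bound: the dehomogenised initial form lies in `𝔮^d` at the landing point (res-D-repro-2's bridge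
`NonRationalWindow.exists_initialForm_mem_pow`), hence the rational landing point lies on the directrix of the A-cone and a non-rational landing forces a
binary cone (`NonRationalWindow.biCone_holds`).

[cite: Matsumura1987, Thm. 14.2] [cite: ZariskiSamuel1960, Ch. VIII §1 Thm. 1] [folklore]
-/

noncomputable section

-- `Summit.<S>.<S>.…` duplicates the summit name by design (single-problem summit).
set_option linter.dupNamespace false

open IsLocalRing
open Literature.AlgebraicGeometry.Resolution
open Summit.ResolutionOfSingularities.ResolutionOfSingularities.Theorems.SwitchingDichotomy.Words

namespace Summit.ResolutionOfSingularities.ResolutionOfSingularities.Theorems.SwitchingDichotomy.ArithTransport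

namespace NearA

universe u

/-! ## §1 Order bookkeeping in a regular local ring -/

section Orders

variable {A : Type u} [CommRing A] [IsRegularLocalRing A]

/-- `ord(a²) ≥ 2m ⇒ ord(a) ≥ m` in a regular local ring (`ord(a²) = 2·ord(a)`). [cite: ZariskiSamuel1960, Ch. VIII §1 Thm. 1] -/
theorem mem_pow_of_sq_mem_pow {a : A} {m : ℕ} (h : a ^ 2 ∈ maximalIdeal A ^ (2 * m)) : a ∈ maximalIdeal A ^ m := by
  rw [← le_adicOrder_iff] at h ⊢
  rw [adicOrder_pow] at h
  rcases eq_or_ne (adicOrder a) ⊤ with htop | hfin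
  · rw [htop]; exact le_top
  · obtain ⟨k, hk⟩ := ENat.ne_top_iff_exists.mp hfin
    rw [← hk] at h ⊢
    have : 2 * m ≤ 2 * k := by exact_mod_cast h
    exact_mod_cast (by omega : m ≤ k)

/-- `u ∈ 𝔪 ∖ 𝔪²` and `u·a ∈ 𝔪^(n+1)` ⇒ `a ∈ 𝔪^n` in a regular local ring (`ord u = 1`, orders add). [cite: ZariskiSamuel1960, Ch. VIII §1 Thm. 1] -/
theorem mem_pow_of_mul_mem_pow_succ {u a : A} (hu : u ∈ maximalIdeal A) (hu2 : u ∉ maximalIdeal A ^ 2) {n : ℕ}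
    (h : u * a ∈ maximalIdeal A ^ (n + 1)) : a ∈ maximalIdeal A ^ n := by
  have hu1 : adicOrder u = 1 := by
    refine le_antisymm ((adicOrder_le_iff u 1).mpr hu2) ?_
    exact_mod_cast (le_adicOrder_iff u 1).mpr (by rw [pow_one]; exact hu)
  rw [← le_adicOrder_iff] at h ⊢
  rw [adicOrder_mul, hu1] at h
  rcases eq_or_ne (adicOrder a) ⊤ with htop | hfin
  · rw [htop]; exact le_top
  · obtain ⟨k, hk⟩ := ENat.ne_top_iff_exists.mp hfin
    rw [← hk] at h ⊢
    have : n + 1 ≤ 1 + k := by exact_mod_cast h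
    exact_mod_cast (by omega : n ≤ k)

end Orders

/-! ## §2 Splitting a square modulo a regular parameter -/

section Split

variable {A : Type u} [CommRing A] [IsRegularLocalRing A]

/-- **Squares split modulo a regular parameter.** `u ∈ 𝔪 ∖ 𝔪²`, `u·c + V² ∈ 𝔪^(2m)` ⇒ `V = V₀ + u·V₁` with `V₀ ∈ 𝔪^m`
(in the regular ring `A/(u)`, `ord(V̄²) = 2·ord(V̄)`). [cite: Matsumura1987, Thm. 14.2] -/
theorem exists_split_of_mul_add_sq_mem {u c V : A} (hu : u ∈ maximalIdeal A) (hu2 : u ∉ maximalIdeal A ^ 2) {m : ℕ}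
    (h : u * c + V ^ 2 ∈ maximalIdeal A ^ (2 * m)) : ∃ V₀ V₁ : A, V₀ ∈ maximalIdeal A ^ m ∧ V = V₀ + u * V₁ := by
  classical
  have hune : Ideal.span ({u} : Set A) ≠ ⊤ := Ideal.span_singleton_ne_top ((mem_maximalIdeal u).mp hu)
  haveI : Nontrivial (A ⧸ Ideal.span ({u} : Set A)) := Ideal.Quotient.nontrivial_iff.mpr hune
  haveI : IsLocalRing (A ⧸ Ideal.span ({u} : Set A)) :=
    IsLocalRing.of_surjective' (Ideal.Quotient.mk _) Ideal.Quotient.mk_surjective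
  haveI hregbar : IsRegularLocalRing (A ⧸ Ideal.span ({u} : Set A)) := (IsRegularLocalRing.quotient_span_singleton hu hu2).1
  set π := Ideal.Quotient.mk (Ideal.span ({u} : Set A)) with hπ
  have hπu : π u = 0 := Ideal.Quotient.eq_zero_iff_mem.mpr (Ideal.mem_span_singleton_self u)
  have hmax : maximalIdeal (A ⧸ Ideal.span ({u} : Set A)) = (maximalIdeal A).map π := maximalIdeal_quotient_eq_map _
  -- `V̄² ∈ 𝔪̄^(2m)`
  have hV2 : π V ^ 2 ∈ maximalIdeal (A ⧸ Ideal.span ({u} : Set A)) ^ (2 * m) := by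
    have := Ideal.mem_map_of_mem π h
    rw [map_add, map_mul, hπu, zero_mul, zero_add, map_pow, Ideal.map_pow, ← hmax] at this
    exact this
  have hVm : π V ∈ maximalIdeal (A ⧸ Ideal.span ({u} : Set A)) ^ m := mem_pow_of_sq_mem_pow hV2
  rw [hmax, ← Ideal.map_pow, Ideal.mem_map_iff_of_surjective π Ideal.Quotient.mk_surjective] at hVm
  obtain ⟨V₀, hV₀, hV₀V⟩ := hVm
  have hdiff : V - V₀ ∈ Ideal.span ({u} : Set A) := by
    rw [← Ideal.Quotient.eq_zero_iff_mem, map_sub, sub_eq_zero]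
    exact hV₀V.symm
  obtain ⟨V₁, hV₁⟩ := Ideal.mem_span_singleton'.mp hdiff
  exact ⟨V₀, V₁, hV₀, by rw [mul_comm, hV₁]; ring⟩

/-- **The parity step.** In a regular local ring of characteristic two with `u ∈ 𝔪 ∖ 𝔪²`: `u·c + V² ∈ 𝔪^(d+1)` for an ODD `d` forces
`c − u·q² ∈ 𝔪^d` for some `q` (split `V = V₀ + uV₁`; `V² = V₀² + u²V₁²`; cancel one `u`). [folklore] -/
theorem exists_sub_mul_sq_mem_pow [CharP A 2] {u c V : A} (hu : u ∈ maximalIdeal A) (hu2 : u ∉ maximalIdeal A ^ 2) {d : ℕ}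
    (hd : Odd d) (h : u * c + V ^ 2 ∈ maximalIdeal A ^ (d + 1)) : ∃ q : A, c - u * q ^ 2 ∈ maximalIdeal A ^ d := by
  obtain ⟨m, rfl⟩ := hd
  have h' : u * c + V ^ 2 ∈ maximalIdeal A ^ (2 * (m + 1)) := by
    rw [show 2 * (m + 1) = 2 * m + 1 + 1 by ring]; exact h
  obtain ⟨V₀, V₁, hV₀, rfl⟩ := exists_split_of_mul_add_sq_mem hu hu2 h'
  have h2 : (2 : A) = 0 := by exact_mod_cast CharP.cast_eq_zero A 2
  refine ⟨V₁, mem_pow_of_mul_mem_pow_succ hu hu2 ?_⟩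
  have hV₀2 : V₀ ^ 2 ∈ maximalIdeal A ^ (2 * m + 1 + 1) := by
    rw [show 2 * m + 1 + 1 = (m + 1) + (m + 1) by ring, pow_add, pow_two]
    exact Ideal.mul_mem_mul hV₀ hV₀
  have key : u * (c - u * V₁ ^ 2) = (u * c + (V₀ + u * V₁) ^ 2) - V₀ ^ 2 - 2 * (u * V₀ * V₁ + u ^ 2 * V₁ ^ 2) := by ring
  rw [key, h2, zero_mul, sub_zero]
  exact Ideal.sub_mem _ h hV₀2

end Split

/-! ## §3 The parity bound at the landing of a visit (run currency) -/

section Run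

variable {K : Type} [Field K] [CharP K 2] {O : ValuationSubring K} {R : ℕ → Subring K} {P : (i : ℕ) → Ideal (R i)}
  {t : K} {s : ℕ → K}

/-- **(N) NEAR-A, part 1 — the PARITY BOUND.** See the module docstring. No cone shape is assumed at either end of the visit. [folklore] -/
theorem parityBound (hrun : IsSteeredRun O R P t 2 s) (hR0 : SubringDominates (R 0) O.toSubring)
    (hreg : ∀ i, IsRegularLocalRing (R i)) {j j' : ℕ} (hvisit : IsVisitPair R P j j') {u : K}
    (hu : (∃ h : u ∈ R j, (⟨u, h⟩ : R j) ∈ P j) ∧ u ≠ 0 ∧ ∀ y : R j, y ∈ P j → O.valuation (y : K) ≤ O.valuation u)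
    (Hγ : ∀ l, j < l → l < j' → ∃ hu : u ∈ R l, P l = Ideal.span {(⟨u, hu⟩ : R l)})
    (h1 : ∀ (hs' : s j' ^ 2 ∈ R j') (Q : Ideal (R j')) [Q.IsPrime], Q.height = 1 →
      ¬ SigmaTopLegality.IsSingPrime (R j') 2 ⟨s j' ^ 2, hs'⟩ Q)
    {d : ℕ} (hd : Odd d) (h3 : 3 ≤ d) (hclj : HasCleanedOrderAt R s 2 j d) (hclj' : HasCleanedOrderAt R s 2 j' (d + 1)) :
    ∃ (_ : IsLocalRing (R j)) (_ : IsLocalRing (R j')) (_ : R j' = R (j + 1)) (hu' : u ∈ R j') (hsj : s j ^ 2 ∈ R j),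
      (⟨u, hu'⟩ : R j') ∈ maximalIdeal (R j') ∧ (⟨u, hu'⟩ : R j') ∉ maximalIdeal (R j') ^ 2 ∧ Prime (⟨u, hu'⟩ : R j') ∧
      ∀ g : R j, (⟨s j ^ 2, hsj⟩ : R j) - g ^ 2 ∈ maximalIdeal (R j) ^ d →
        ∃ f₁ q : R j', ((((⟨s j ^ 2, hsj⟩ : R j) - g ^ 2 : R j) : K)) = u ^ d * (f₁ : K) ∧
          f₁ - ⟨u, hu'⟩ * q ^ 2 ∈ maximalIdeal (R j') ^ d := by
  classical
  haveI hRloc : ∀ i, IsLocalRing (R i) := fun i => (hrun.2 i).1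
  have hdom : ∀ i, SubringDominates (R i) O.toSubring := fun i => VisitLawPointStep.subringDominates_of_run hrun hR0 i
  have hbl : ∀ i, IsLocalBlowupAlong O (R i) (P i) (R (i + 1)) := fun i => (hrun.2 i).2.2.2.1
  have h2K : (2 : K) = 0 := CharTwo.two_eq_zero
  -- ### the point step `j` and its exceptional parameter
  obtain ⟨_, hPj⟩ := hvisit.2.1
  have hutrip := hu
  obtain ⟨⟨huR, huP⟩, hu0, humax⟩ := hu
  have hum : (⟨u, huR⟩ : R j) ∈ maximalIdeal (R j) := by rw [← hPj]; exact huP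
  have humax' : ∀ y : R j, y ∈ maximalIdeal (R j) → O.valuation (y : K) ≤ O.valuation u :=
    fun y hy => humax y (by rw [hPj]; exact hy)
  have hbl𝔪 : IsLocalBlowupAlong O (R j) (maximalIdeal (R j)) (R (j + 1)) := by rw [← hPj]; exact hbl j
  haveI hregj : IsRegularLocalRing (R j) := hreg j
  haveI hreg1 : IsRegularLocalRing (R (j + 1)) := hreg (j + 1)
  have hle : R j ≤ R (j + 1) := (hbl j).isLocalBlowup.le
  have hu1 : u ∈ R (j + 1) := hle huR
  obtain ⟨hum1, hu21, hprime1⟩ := VisitLawPointStep.prime_excParam_succ hrun hR0 hvisit.2.1 (hreg j) (hreg (j + 1)) hutrip hu1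
  -- ### the visit law
  obtain ⟨⟨hRj', G, W, hG, hW, hWinv, hW0, hlaw⟩, -, -⟩ :=
    VisitLawDelta.visitLaw₂_of_run hrun hR0 hvisit hutrip Hγ hreg h1 (by omega : 2 ≤ d) hclj
  have hsj : s j ^ 2 ∈ R j := VisitLawPointStep.pow_mem_of_run hrun j
  have hsj' : s j' ^ 2 ∈ R j' := VisitLawPointStep.pow_mem_of_run hrun j'
  -- ### transport the `u`-facts to the index `j′`
  have key : ∀ (S : Subring K) (hS : S = R (j + 1)) [IsLocalRing S] (huS : u ∈ S),
      (⟨u, huS⟩ : S) ∈ maximalIdeal S ∧ (⟨u, huS⟩ : S) ∉ maximalIdeal S ^ 2 ∧ Prime (⟨u, huS⟩ : S) := by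
    intro S hS _ huS
    subst hS
    exact ⟨hum1, hu21, hprime1⟩
  have hu' : u ∈ R j' := by rw [hRj']; exact hu1
  obtain ⟨hum', hu2', hprime'⟩ := key (R j') hRj' hu'
  haveI hregj' : IsRegularLocalRing (R j') := hreg j'
  haveI := isDomain_of_isRegularLocalRing (R j')
  haveI := isIntegrallyClosed_of_isRegularLocalRing (R j')
  have hu0' : (⟨u, hu'⟩ : R j') ≠ 0 := fun h0 => hu0 (congrArg Subtype.val h0)
  refine ⟨hRloc j, hRloc j', hRj', hu', hsj, hum', hu2', hprime', fun g hg => ?_⟩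
  -- ### the weak transform `f₁` of `F := f_j − g²` (order exactly `d` by the cleaned-order clause at `j`)
  obtain ⟨_, hsj0, -, hmaxj⟩ := hclj
  have hsjeq : (⟨s j ^ 2, hsj0⟩ : R j) = ⟨s j ^ 2, hsj⟩ := Subtype.ext rfl
  have hgnot : (⟨s j ^ 2, hsj⟩ : R j) - g ^ 2 ∉ maximalIdeal (R j) ^ (d + 1) := by rw [← hsjeq]; exact hmaxj g
  obtain ⟨w, hw, -⟩ := PointStepOrderBound.div_pow_not_mem_pow_succ_of_pointStep (hdom j) hbl𝔪 huR hum hu0 humax' hg hgnot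
  -- `w ∈ R (j+1)`; it will be moved to `R j′`
  have hwj' : (w : K) ∈ R j' := by rw [hRj']; exact w.2
  -- ### the visit law squared: `u^(d−1) · (u f₁ + W² f′) = (G + g)²`
  obtain ⟨e, rfl⟩ := hd
  have he : (2 * e + 1) / 2 = e := by omega
  rw [he] at hlaw
  have hgK : ((g : R j) : K) ∈ R j' := by rw [hRj']; exact hle g.2
  have hwK : s j ^ 2 - ((g : R j) : K) ^ 2 = u ^ (2 * e + 1) * (w : K) := by
    have := hw
    push_cast at this
    rw [← this]; ring
  have hK : u ^ (2 * e) * (u * (w : K) + W ^ 2 * s j' ^ 2) = (G + ((g : R j) : K)) ^ 2 := by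
    have hsq : (s j' * u ^ e * W) ^ 2 = (s j - G) ^ 2 := by rw [hlaw]
    linear_combination hsq - hwK + (s j ^ 2 - ((g : R j) : K) ^ 2 - G * ((g : R j) : K) - s j * G) * h2K
  have hRj : (⟨u, hu'⟩ : R j') ^ (2 * e) * (⟨u, hu'⟩ * ⟨(w : K), hwj'⟩ + ⟨W, hW⟩ ^ 2 * ⟨s j' ^ 2, hsj'⟩) =
      ((⟨G, hG⟩ : R j') + ⟨((g : R j) : K), hgK⟩) ^ 2 := by
    apply Subtype.ext
    push_cast
    exact hK
  obtain ⟨T, hT⟩ := sq_of_pow_mul_eq_sq hu0' e hRj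
  -- ### the cleaner at `j′`: `u f₁ + (T + W h)² = W²(f′ − h²) ∈ 𝔪′^(d+1)` (characteristic two)
  obtain ⟨_, hsj'0, ⟨h, hh⟩, -⟩ := hclj'
  have hf'eq : (⟨s j' ^ 2, hsj'0⟩ : R j') = ⟨s j' ^ 2, hsj'⟩ := Subtype.ext rfl
  rw [hf'eq] at hh
  have h2 : (2 : R j') = 0 := by exact_mod_cast CharP.cast_eq_zero (R j') 2
  have hsum : (⟨u, hu'⟩ : R j') * ⟨(w : K), hwj'⟩ + (T + ⟨W, hW⟩ * h) ^ 2 ∈ maximalIdeal (R j') ^ (2 * e + 1 + 1) := by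
    have key2 : (⟨u, hu'⟩ : R j') * ⟨(w : K), hwj'⟩ + (T + ⟨W, hW⟩ * h) ^ 2 =
        ⟨W, hW⟩ ^ 2 * (⟨s j' ^ 2, hsj'⟩ - h ^ 2) + 2 * (T ^ 2 - ⟨W, hW⟩ ^ 2 * ⟨s j' ^ 2, hsj'⟩ + T * ⟨W, hW⟩ * h + ⟨W, hW⟩ ^ 2 * h ^ 2) +
          ((⟨u, hu'⟩ * ⟨(w : K), hwj'⟩ + ⟨W, hW⟩ ^ 2 * ⟨s j' ^ 2, hsj'⟩) - T ^ 2) := by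
      ring
    rw [key2, h2, zero_mul, add_zero, hT, sub_self, add_zero]
    exact Ideal.mul_mem_left _ _ hh
  obtain ⟨q, hq⟩ := exists_sub_mul_sq_mem_pow hum' hu2' ⟨e, rfl⟩ hsum
  refine ⟨⟨(w : K), hwj'⟩, q, ?_, hq⟩
  push_cast
  exact hwK

end Run

end NearA

end Summit.ResolutionOfSingularities.ResolutionOfSingularities.Theorems.SwitchingDichotomy.ArithTransport

end
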